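import Summits.QuantumFields.YangMills.Theorems.UnitScaleTiltProp7DivRecoveryAssemblyCore
import Summits.QuantumFields.YangMills.Theorems.UnitScaleTiltProp7TwistedIntertwiningRows
import Summits.QuantumFields.YangMills.Theorems.UnitScaleTiltProp7DivRecoveryForm
import HarnessLib

/-!
# Prop. 7 on T³ — lane II (B7-MEMBER-CORE): the (REC) core row AT THE MEMBER, `T := Q_k(W)` (the comb averaging of record)

Route `UnitScaleTilt`, crux `MinimiserStabilityRegPr` (stmt-QuantumFields-19200), E′ growth side, lane II «divergence recovery at the curved regular member».
✓`Prop7DivRecoveryAssemblyCore.norm_sq_le_rows_H1` (B7-CORE §5) instantiated at the member's letters: `S :=` gauge parameters `SiteL2K`, `E :=` one-forms `BondL2K`,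
`D := DL2 W` (`D† = DstarL2 W`, ✓`adjoint_DL2`), `Q′ := QprimeCombL2 W`, projector `RcombL2 W` (✓`RcombL2_isSymmetric`∕`RcombL2_idem`∕✓`inner_covLapSite_eq_of_ker` give the
two orthogonality hypotheses), `T := √((c₀∕cB)ℓ³)·Qkc W` so that `‖T y‖²` IS the resource `a₀⁻¹·AVG` of (REC) and `htube` IS ✓`Prop7TwistedIntertwining.intertwining_rows`'
second conjunct ((B3a), LANE II NAMER WORD №9).  The remaining rows are DISPLAYED hypotheses with named pens: the smooth right inverse `J` with its gradient row ((B2a),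
SIGNATURE-0 `exists_smoothRightInverse_QprimeCombL2`), the coarse contraction rows `hGN`∕`hQN`, the `H¹`-row (QH1) of `Qkc`, the cutoff families `Z`∕`ZE` ((B6)), the local
potential rows `hloc`∕`hDφ` ((B8)).

HONEST SCOPE.  One `exact` of the abstract core after unit conversions; nothing of (REC)∕hN06∕hcoS∕E′∕EX∕the crux is proved here; YM₃ on T³ is rung R3 — NOT d = 4, NOT
infinite volume, NOT a mass gap, NOT Clay.
[cite: Balaban1985BackgroundPropagators, (3.8) p.392, (3.10) p.392, (3.19)-(3.26) pp.393-395]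
-/

noncomputable section

open scoped InnerProductSpace ComplexConjugate BigOperators Matrix.Norms.L2Operator

namespace Summit.QuantumFields.YangMills.Theorems.Prop7DivRecoveryAssemblyHilbert

open Literature.MathematicalPhysics.QuantumFieldTheory.Balaban1983to89
open Literature.MathematicalPhysics.QuantumFieldTheory.Balaban1983to89.T3ContinuumYM3Torus
open T3LevelShift (bondShift)
open T3PrintedRegularOrbits (sites_eq)
open T3SectALandauChart (bgUnits)
open B7Eq78Linearization (conjR)
open B7Prop1Explicit (U1)
open B11Eq103H1Complex (SiteL2K BondL2K)
open Summit.QuantumFields.YangMills.Theorems.Prop7SymAvgGL (descendToGL)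
open Summit.QuantumFields.YangMills.Theorems.Prop7SectET3Transport (periodsT3)
open Summit.QuantumFields.YangMills.Theorems.Prop7SectET3HilbertLetters (W₂ DL2 DstarL2 covLapSite adjoint_DL2)
open Summit.QuantumFields.YangMills.Theorems.Prop7SectET3CombLetters (Qkc)
open Summit.QuantumFields.YangMills.Theorems.Prop7QprimeCombL2 (QprimeCombL2 RcombL2 RcombL2_isSymmetric RcombL2_idem)
open Summit.QuantumFields.YangMills.Theorems.Prop7DivRecoveryForm (inner_covLapSite_eq_of_ker inner_self_of_isSymmetric_idem)
open Summit.QuantumFields.YangMills.Theorems.Prop7DivRecoveryAssemblyCore (norm_sq_le_rows_H1)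

variable (c₀ cB : ℕ → ℝ) [hc₀ : ∀ L : ℕ, Fact (0 < c₀ L)] [hcB : ∀ L : ℕ, Fact (0 < cB L)]

/-- ★★★ **(B7-MEMBER-CORE) THE (REC) CORE ROW AT THE MEMBER, `T := Q_k(W)`.**  For a member `W` of the family at levels `n < K` (`ℓ = L^{K−n}`) and a one-form `y`:
with `v := D*_W y`, `g := v − R_W v`, the coarse currencies `Gc w := c₀ℓ³·Σ_c ‖Ad(Ū(c)) w(c₊) − w(c₋)‖²` (`Ū := descendToGL … (bgUnits W)`, (B3)'s transporter) and
`Nc w := c₀ℓ³·Σ_y ‖w y‖²`, and the displayed rows — (B3a) `h3a` (✓`intertwining_rows`' second conjunct VERBATIM), the coarse contractions `hGN`, `hQN`, the smooth right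
inverse `J` ((B2a): `hQJ`, `hJrow`), the `H¹`-row (QH1) `hQH1` of the comb averaging, the cutoffs (B6) `hZ`∕`hZE`, the local potentials (B8) `hloc`∕`hDφ` —
`‖g‖² ≤ 288κ²CJ·((c₀∕cB)ℓ³‖Qkc W y‖²) + 288κ²CJ·B·(‖Σ ZE_i r_i‖² + ‖Σ (D(Z_iφ_i) − ZE_i(Dφ_i))‖²) + 288κ²CJ·B′·(H(Σ ZE_i r_i) + H(Σ (D(Z_iφ_i) − ZE_i(Dφ_i))))`
`      + 48κ²(CJ·(c₀∕cB)C3 + CJ′·CN)·e²·‖Σ Z_iφ_i‖² + 3‖Σ (Δ_W(Z_iφ_i) − Z_i(Δ_Wφ_i))‖² + 3‖Σ Z_iκ_i‖²`, `κ² = CJ·CG·CN + CJ′·CN·e² + 1` — the first term IS `a₀⁻¹·AVG`.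
[cite: Balaban1985BackgroundPropagators, (3.10) p.392, (3.19)-(3.26) pp.393-395] -/
theorem member_core_row (F : T3Family) (n K : ℕ) (hnK : n < K) (e : ℝ)
    (W : GaugeField (F.P K) 0 (Matrix.specialUnitaryGroup (Fin 2) ℂ))
    {C3 : ℝ}
    (h3a : ∀ l : SiteL2K ℂ 3 (periodsT3 F K) (c₀ F.L) W₂,
      cB F.L * ∑ c : PBond (F.P K) (K - n), ‖conjR (descendToGL F n K hnK.le (bgUnits F K W) ((bondShift (sites_eq F n K hnK.le)).symm c))
          (QprimeCombL2 F n K (c₀ F.L) W l (c.src.shift c.dir)) - QprimeCombL2 F n K (c₀ F.L) W l c.src‖ ^ 2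
        ≤ 2 * ‖Qkc F n K hnK.le (c₀ F.L) (cB F.L) W (DL2 F n K (c₀ F.L) W l)‖ ^ 2 + C3 * e ^ 2 * ((((F.L : ℝ) ^ (K - n)) ^ 3)⁻¹ * ‖l‖ ^ 2))
    {CG CN : ℝ} (hCG : 0 ≤ CG) (hCN : 0 ≤ CN)
    (hGN : ∀ w : Site (F.P K) (K - n) → Matrix (Fin 2) (Fin 2) ℂ,
      c₀ F.L * ((F.L : ℝ) ^ (K - n)) ^ 3 * ∑ c : PBond (F.P K) (K - n), ‖conjR (descendToGL F n K hnK.le (bgUnits F K W) ((bondShift (sites_eq F n K hnK.le)).symm c))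
          (w (c.src.shift c.dir)) - w c.src‖ ^ 2
        ≤ CG * (c₀ F.L * ((F.L : ℝ) ^ (K - n)) ^ 3 * ∑ y : Site (F.P K) (K - n), ‖w y‖ ^ 2))
    (hQN : ∀ μ : SiteL2K ℂ 3 (periodsT3 F K) (c₀ F.L) W₂,
      c₀ F.L * ((F.L : ℝ) ^ (K - n)) ^ 3 * ∑ y : Site (F.P K) (K - n), ‖QprimeCombL2 F n K (c₀ F.L) W μ y‖ ^ 2 ≤ CN * ‖μ‖ ^ 2)
    (J : (Site (F.P K) (K - n) → Matrix (Fin 2) (Fin 2) ℂ) →ₗ[ℂ] SiteL2K ℂ 3 (periodsT3 F K) (c₀ F.L) W₂)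
    (hQJ : ∀ w, QprimeCombL2 F n K (c₀ F.L) W (J w) = w) {CJ CJ' : ℝ} (hCJ : 0 ≤ CJ) (hCJ' : 0 ≤ CJ')
    (hJrow : ∀ w, ‖DL2 F n K (c₀ F.L) W (J w)‖ ^ 2
      ≤ CJ * (c₀ F.L * ((F.L : ℝ) ^ (K - n)) ^ 3 * ∑ c : PBond (F.P K) (K - n), ‖conjR (descendToGL F n K hnK.le (bgUnits F K W) ((bondShift (sites_eq F n K hnK.le)).symm c))
          (w (c.src.shift c.dir)) - w c.src‖ ^ 2)
        + CJ' * e ^ 2 * (c₀ F.L * ((F.L : ℝ) ^ (K - n)) ^ 3 * ∑ y : Site (F.P K) (K - n), ‖w y‖ ^ 2))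
    (H : BondL2K ℂ 3 (periodsT3 F K) (c₀ F.L) W₂ → ℝ) {B B' : ℝ}
    (hQH1 : ∀ f : BondL2K ℂ 3 (periodsT3 F K) (c₀ F.L) W₂,
      (c₀ F.L / cB F.L) * ((F.L : ℝ) ^ (K - n)) ^ 3 * ‖Qkc F n K hnK.le (c₀ F.L) (cB F.L) W f‖ ^ 2 ≤ B * ‖f‖ ^ 2 + B' * H f)
    {ι : Type*} [Fintype ι]
    (Z : ι → SiteL2K ℂ 3 (periodsT3 F K) (c₀ F.L) W₂ →ₗ[ℂ] SiteL2K ℂ 3 (periodsT3 F K) (c₀ F.L) W₂) (hZ : ∀ s, ∑ i, Z i s = s)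
    (ZE : ι → BondL2K ℂ 3 (periodsT3 F K) (c₀ F.L) W₂ →ₗ[ℂ] BondL2K ℂ 3 (periodsT3 F K) (c₀ F.L) W₂) (hZE : ∀ f, ∑ i, ZE i f = f)
    (y : BondL2K ℂ 3 (periodsT3 F K) (c₀ F.L) W₂) (φ κs : ι → SiteL2K ℂ 3 (periodsT3 F K) (c₀ F.L) W₂)
    (hloc : ∀ i, Z i (DstarL2 F n K (c₀ F.L) W y) = Z i (covLapSite F n K (c₀ F.L) W (φ i)) + Z i (κs i))
    (r : ι → BondL2K ℂ 3 (periodsT3 F K) (c₀ F.L) W₂) (hDφ : ∀ i, ZE i (DL2 F n K (c₀ F.L) W (φ i)) = ZE i y - ZE i (r i)) :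
    ‖DstarL2 F n K (c₀ F.L) W y - RcombL2 F n K (c₀ F.L) W (DstarL2 F n K (c₀ F.L) W y)‖ ^ 2
      ≤ 288 * (CJ * CG * CN + CJ' * CN * e ^ 2 + 1) * CJ * ((c₀ F.L / cB F.L) * ((F.L : ℝ) ^ (K - n)) ^ 3 * ‖Qkc F n K hnK.le (c₀ F.L) (cB F.L) W y‖ ^ 2)
        + 288 * (CJ * CG * CN + CJ' * CN * e ^ 2 + 1) * CJ * B
            * (‖∑ i, ZE i (r i)‖ ^ 2 + ‖∑ i, (DL2 F n K (c₀ F.L) W (Z i (φ i)) - ZE i (DL2 F n K (c₀ F.L) W (φ i)))‖ ^ 2)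
        + 288 * (CJ * CG * CN + CJ' * CN * e ^ 2 + 1) * CJ * B'
            * (H (∑ i, ZE i (r i)) + H (∑ i, (DL2 F n K (c₀ F.L) W (Z i (φ i)) - ZE i (DL2 F n K (c₀ F.L) W (φ i)))))
        + 48 * (CJ * CG * CN + CJ' * CN * e ^ 2 + 1) * (CJ * ((c₀ F.L / cB F.L) * C3) + CJ' * CN) * e ^ 2 * ‖∑ i, Z i (φ i)‖ ^ 2
        + 3 * ‖∑ i, (covLapSite F n K (c₀ F.L) W (Z i (φ i)) - Z i (covLapSite F n K (c₀ F.L) W (φ i)))‖ ^ 2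
        + 3 * ‖∑ i, Z i (κs i)‖ ^ 2 := by
  -- positivity of the weights
  have hc : 0 < c₀ F.L := (hc₀ F.L).out
  have hb : 0 < cB F.L := (hcB F.L).out
  have hL0 : (0 : ℝ) < F.L := by have := F.hL.2; exact_mod_cast (show 0 < F.L by omega)
  set ℓ3 : ℝ := ((F.L : ℝ) ^ (K - n)) ^ 3 with hℓ3
  have hℓ3pos : 0 < ℓ3 := by rw [hℓ3]; positivity
  set ρ : ℝ := (c₀ F.L / cB F.L) * ℓ3 with hρ
  have hρpos : 0 < ρ := by rw [hρ]; positivity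
  -- the adjoint and the Laplacian letters
  have hadj : LinearMap.adjoint (DL2 F n K (c₀ F.L) W) = DstarL2 F n K (c₀ F.L) W := adjoint_DL2 W
  have hΔ : ∀ s, covLapSite F n K (c₀ F.L) W s = DstarL2 F n K (c₀ F.L) W (DL2 F n K (c₀ F.L) W s) := fun s => rfl
  -- the scaled comb averaging
  set T : BondL2K ℂ 3 (periodsT3 F K) (c₀ F.L) W₂ →ₗ[ℂ] _ := ((Real.sqrt ρ : ℝ) : ℂ) • Qkc F n K hnK.le (c₀ F.L) (cB F.L) W with hT
  have hTnorm : ∀ f, ‖T f‖ ^ 2 = ρ * ‖Qkc F n K hnK.le (c₀ F.L) (cB F.L) W f‖ ^ 2 := fun f => by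
    rw [hT, LinearMap.smul_apply, norm_smul, Complex.norm_real, Real.norm_of_nonneg (Real.sqrt_nonneg _), mul_pow, Real.sq_sqrt hρpos.le]
  -- the currencies
  set Gc : (Site (F.P K) (K - n) → Matrix (Fin 2) (Fin 2) ℂ) → ℝ := fun w =>
    c₀ F.L * ℓ3 * ∑ c : PBond (F.P K) (K - n), ‖conjR (descendToGL F n K hnK.le (bgUnits F K W) ((bondShift (sites_eq F n K hnK.le)).symm c))
      (w (c.src.shift c.dir)) - w c.src‖ ^ 2 with hGc
  set Nc : (Site (F.P K) (K - n) → Matrix (Fin 2) (Fin 2) ℂ) → ℝ := fun w => c₀ F.L * ℓ3 * ∑ y : Site (F.P K) (K - n), ‖w y‖ ^ 2 with hNc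
  have hNc0 : ∀ w, 0 ≤ Nc w := fun w => by rw [hNc]; positivity
  -- htube from (B3a)
  have htube : ∀ μ : SiteL2K ℂ 3 (periodsT3 F K) (c₀ F.L) W₂,
      Gc (QprimeCombL2 F n K (c₀ F.L) W μ) ≤ 2 * ‖T (DL2 F n K (c₀ F.L) W μ)‖ ^ 2 + (c₀ F.L / cB F.L * C3) * e ^ 2 * ‖μ‖ ^ 2 := by
    intro μ
    have h := h3a μ
    have hmul := mul_le_mul_of_nonneg_left h (show 0 ≤ c₀ F.L / cB F.L * ℓ3 by positivity)
    have hlhs : c₀ F.L / cB F.L * ℓ3 * (cB F.L * ∑ c : PBond (F.P K) (K - n), ‖conjR (descendToGL F n K hnK.le (bgUnits F K W) ((bondShift (sites_eq F n K hnK.le)).symm c))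
          (QprimeCombL2 F n K (c₀ F.L) W μ (c.src.shift c.dir)) - QprimeCombL2 F n K (c₀ F.L) W μ c.src‖ ^ 2) = Gc (QprimeCombL2 F n K (c₀ F.L) W μ) := by
      rw [hGc]; field_simp
    have hrhs : c₀ F.L / cB F.L * ℓ3 * (2 * ‖Qkc F n K hnK.le (c₀ F.L) (cB F.L) W (DL2 F n K (c₀ F.L) W μ)‖ ^ 2 + C3 * e ^ 2 * (ℓ3⁻¹ * ‖μ‖ ^ 2))
        = 2 * ‖T (DL2 F n K (c₀ F.L) W μ)‖ ^ 2 + (c₀ F.L / cB F.L * C3) * e ^ 2 * ‖μ‖ ^ 2 := by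
      rw [hTnorm, hρ]; field_simp
    rw [hlhs, hrhs] at hmul
    exact hmul
  -- hT' from (QH1)
  have hT' : ∀ f, ‖T f‖ ^ 2 ≤ B * ‖f‖ ^ 2 + B' * H f := fun f => by rw [hTnorm, hρ]; exact hQH1 f
  -- hgv and hg from the projector of record
  have hgv : ‖DstarL2 F n K (c₀ F.L) W y - RcombL2 F n K (c₀ F.L) W (DstarL2 F n K (c₀ F.L) W y)‖ ^ 2
      ≤ RCLike.re ⟪DstarL2 F n K (c₀ F.L) W y - RcombL2 F n K (c₀ F.L) W (DstarL2 F n K (c₀ F.L) W y), DstarL2 F n K (c₀ F.L) W y⟫_ℂ := by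
    set v := DstarL2 F n K (c₀ F.L) W y
    set Rp := RcombL2 F n K (c₀ F.L) W
    have hsym : ⟪v, Rp v⟫_ℂ = ((‖Rp v‖ : ℝ) : ℂ) ^ 2 := inner_self_of_isSymmetric_idem Rp (RcombL2_isSymmetric W) (RcombL2_idem W) v
    have h1 : ⟪v - Rp v, v⟫_ℂ = ⟪v - Rp v, v - Rp v⟫_ℂ + ⟪v - Rp v, Rp v⟫_ℂ := by rw [← inner_add_right, sub_add_cancel]
    have h2 : ⟪v - Rp v, Rp v⟫_ℂ = 0 := by
      rw [inner_sub_left, hsym, inner_self_eq_norm_sq_to_K]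
      exact sub_eq_zero.mpr (by norm_cast)
    rw [h1, h2, add_zero, inner_self_eq_norm_sq_to_K]
    norm_cast
  have hg : ∀ l, QprimeCombL2 F n K (c₀ F.L) W l = 0 →
      ⟪DstarL2 F n K (c₀ F.L) W y - RcombL2 F n K (c₀ F.L) W (DstarL2 F n K (c₀ F.L) W y),
        LinearMap.adjoint (DL2 F n K (c₀ F.L) W) (DL2 F n K (c₀ F.L) W l)⟫_ℂ = 0 := fun l hl => by
    rw [hadj, ← hΔ, inner_sub_left, inner_covLapSite_eq_of_ker F n K (c₀ F.L) W _ hl, sub_self]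
  have hloc' : ∀ i, Z i (DstarL2 F n K (c₀ F.L) W y)
      = Z i (LinearMap.adjoint (DL2 F n K (c₀ F.L) W) (DL2 F n K (c₀ F.L) W (φ i))) + Z i (κs i) := fun i => by
    rw [hadj, ← hΔ]; exact hloc i
  -- the abstract core
  have hcore := norm_sq_le_rows_H1 (DL2 F n K (c₀ F.L) W) (QprimeCombL2 F n K (c₀ F.L) W) J hQJ Gc Nc hCJ hCJ' hCG hCN hNc0 hJrow hGN hQN
    T H hT' htube Z hZ ZE hZE (DstarL2 F n K (c₀ F.L) W y) _ hgv hg φ κs hloc' y r hDφ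
  -- read back
  rw [hTnorm y, hadj] at hcore
  simp only [hΔ]
  exact hcore

end Summit.QuantumFields.YangMills.Theorems.Prop7DivRecoveryAssemblyHilbert

end
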